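import Summits.MatrixMultiplication.MatrixMultiplication.Theorems.FarEdgeDescentLogRateSharp
import Summits.MatrixMultiplication.MatrixMultiplication.Theorems.FarEdgeDescentFirstPowerCeilingCert

/-!
# Route `FarEdgeDescent` — the CEILING of the first-power `CW_q` class at the far edge (`c₁` is exact)

decomp-mm ROOT cell (D-0178), lens 2 «structural dichotomy: special vs generic», gen 41 (Kernel XVI, file 2 of 2).

The landed files `FarEdgeDescentLogRate` / `FarEdgeDescentLogRateSharp` prove the UPPER side of the special-side
rate ladder: the full first-power Coppersmith–Winograd certificate `cwFullFirstPowerValue q k σ ρ ≥ ω(1,k,1)`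
(all `q ≥ 2` and all symmetric joint types `(m, m, k·m; s, s, r)` of `CW_q`, i.e. all `σ, ρ ≥ 0`, `2σ + ρ < 1`)
realises EVERY constant `c > c₁ := (3/2) log 3 − 2 log 2 = 0.2616…`
in `ω(1,k,1) − (k+1) ≤ c / log k` eventually (`logRateSharp_explicit`), and the open aside `SubLogRate`
(stmt-MatrixMultiplication-25371) lives at or below the constant (`subLogRate_iff_below_constant`).
This file proves the CONVERSE for the whole landed certificate family — a METHOD CEILING, by theorem:

* `firstPowerCeiling` : for every `c < c₁` there is `k₀` such that for all `k ≥ k₀` and ALL admissible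
  `q ≥ 2`, `σ, ρ ≥ 0`, `2σ + ρ < 1`:  `k + 1 + c / log k ≤ cwFullFirstPowerValue q k σ ρ`
  (`firstPowerCeiling_integer`: the same for the integer instances fed into `ω(1,k,1)` by
  `cwFirstPowerIntegerCertificate_holds`).  With `logRateSharp_explicit`, `c₁` is the EXACT far-edge constant
  of the class (`firstPower_rate_dichotomy`), and under the aside 25371 `ω(1,k,1)` is eventually STRICTLY below
  every value of the class (`omegaRect_lt_firstPower_of_subLogRate`): 25371 needs an idea, not a parameter choice.

Proof: (1) `q`-elimination (`entropyRef_le_log`, part 1) reduces to `min(H_Y, H_X) ≤ H(x,(1−x)/2,(1−x)/2)` with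
`β = (1−2σ−ρ)/(k+2)`, `c' = c/log k`, `x = (k+1+c')β`; (2) the certificates `certX`/`certY`/`certF` of part 1;
(3) coverage (`negSlack_consequences`): where `certX` has negative slack, `ρ < σ` and `2σ ≥ (1+c')β` as soon as
`log k ≥ (5/2)·c/(c₁ − c)`, and then `certY` (`x ≥ 1/3`) or `certF` (`x < 1/3`, `k ≥ 341`) applies.
The statement is genuinely EVENTUAL: numerically `inf over the family of (value − k − 1)·log k ≈ 0.187 (k=2),
0.241 (k=3) < c₁ < 0.265 (k=4), 0.294 (k=10), 0.291 (k=10²), 0.283 (k=10³), 0.278 (k=10⁴), 0.273 (k=10⁶),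
0.270 (k=10⁸) ↓ c₁ = 0.2616` (lens scan, gen 41 memo §3).
NO definitions (gate rule D-0009); `c₁` is written out literally.  Nothing here proves `ω = 2`.
-/

set_option linter.dupNamespace false

noncomputable section

namespace Summit.MatrixMultiplication.MatrixMultiplication.Theorems.FarEdgeDescentFirstPowerCeiling

open Literature.Computability.AlgebraicComplexity
open Summit.MatrixMultiplication.MatrixMultiplication.Theorems.FarEdgeDescentLogRate
  (shannon₃ cwFullFirstPowerValue CwFirstPowerIntegerCertificate cwFirstPowerIntegerCertificate_holds)
open Summit.MatrixMultiplication.MatrixMultiplication.Theorems.FarEdgeDescentLogRateSharp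
  (cwFarEdgeConstant_pos cwFarEdgeConstant_bounds logRateSharp_explicit)
open Summit.MatrixMultiplication.MatrixMultiplication.Theorems.FarEdgeDescentFirstPowerCeilingCert
open Summit.MatrixMultiplication.MatrixMultiplication.Theses.FarEdgeDescent (SubLogRate)

/-! ## Step (3): coverage and the ceiling theorem -/

/-- The logarithmic correction `log((1−x)/x)` in the X-slack is at least `−log(2(k+2))` (`c' ≤ 1/2`). -/
theorem logCorrection_lower {k β c' x : ℝ} (hk : 0 ≤ k) (hβ : 0 < β) (hc' : 0 < c') (hc'h : c' ≤ 1 / 2)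
    (hx : x = (k + 1 + c') * β) (h1x : (1 - c') * β ≤ 1 - x) :
    -(Real.log 2 + Real.log (k + 2)) ≤ Real.log (1 - x) - Real.log x := by
  have h1c : 0 < (1 - c') * β := mul_pos (by linarith) hβ
  have e1 : Real.log ((1 - c') * β) ≤ Real.log (1 - x) := Real.log_le_log h1c h1x
  rw [Real.log_mul (by linarith) hβ.ne'] at e1
  have e2 : Real.log x = Real.log (k + 1 + c') + Real.log β := by
    rw [hx, Real.log_mul (by linarith) hβ.ne']
  have e3 : Real.log (1 / 2) ≤ Real.log (1 - c') := Real.log_le_log (by norm_num) (by linarith)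
  rw [Real.log_div one_ne_zero two_ne_zero, Real.log_one, zero_sub] at e3
  have e4 : Real.log (k + 1 + c') ≤ Real.log (k + 2) := Real.log_le_log (by linarith) (by linarith)
  linarith

/-- COVERAGE.  Where the X-slack (with the correction bounded below by `L`) is negative and `k` is past the
threshold `c'·(3 log 2 − (1/2) log 3 + log(k+2)) ≤ c₁`, one has `ρ < σ` and `(1 + c')β ≤ 2σ`
(the linearised X-region `{(σ/β − 1/2)·log(4/3) ≤ (ρ/β)·log(3/2) + slack}` contains `{2σ ≤ (1+c')β}` and
`{σ ≤ ρ}` because `log(4/3) < log(3/2)`). -/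
theorem negSlack_consequences {k β σ ρ c' L : ℝ} (hβ : 0 < β) (hρ : 0 ≤ ρ) (hc' : 0 < c')
    (hT : c' * (3 * Real.log 2 - 1 / 2 * Real.log 3 + Real.log (k + 2)) ≤ 3 / 2 * Real.log 3 - 2 * Real.log 2)
    (hL : -(Real.log 2 + Real.log (k + 2)) ≤ L)
    (hneg : β * (Real.log 3 - (1 + c') * Real.log 2) + σ * (Real.log 3 - 2 * Real.log 2) +
      ρ * (Real.log 3 - Real.log 2) + c' * β * L < 0) :
    ρ < σ ∧ (1 + c') * β ≤ 2 * σ := by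
  -- `3 log 2 ≤ 2 log 3` (`8 ≤ 9`) and `log 3 < 2 log 2` (`3 < 4`)
  have h98 : 3 * Real.log 2 ≤ 2 * Real.log 3 := by
    have h : Real.log 8 ≤ Real.log 9 := Real.log_le_log (by norm_num) (by norm_num)
    rw [show (8 : ℝ) = 2 ^ 3 by norm_num, show (9 : ℝ) = 3 ^ 2 by norm_num, Real.log_pow, Real.log_pow] at h
    push_cast at h
    linarith
  have hl43 : 0 < 2 * Real.log 2 - Real.log 3 := by
    have h : Real.log 3 < Real.log 4 := Real.log_lt_log (by norm_num) (by norm_num)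
    rw [show (4 : ℝ) = 2 ^ 2 by norm_num, Real.log_pow] at h
    push_cast at h
    linarith
  have hlow := mul_le_mul_of_nonneg_left hL (mul_pos hc' hβ).le
  -- the `β`-coefficient `A` of the linearised slack is at least `(1 + c')·log(4/3)/2`
  have hA : (1 + c') * (2 * Real.log 2 - Real.log 3) / 2 ≤
      Real.log 3 - Real.log 2 - c' * Real.log 2 - c' * (Real.log 2 + Real.log (k + 2)) := by linarith
  have hσlow : β * (Real.log 3 - Real.log 2 - c' * Real.log 2 - c' * (Real.log 2 + Real.log (k + 2))) +
      ρ * (Real.log 3 - Real.log 2) < σ * (2 * Real.log 2 - Real.log 3) := by linarith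
  have hA0 : 0 ≤ Real.log 3 - Real.log 2 - c' * Real.log 2 - c' * (Real.log 2 + Real.log (k + 2)) := by
    have : 0 ≤ (1 + c') * (2 * Real.log 2 - Real.log 3) := mul_nonneg (by linarith) hl43.le
    linarith
  have hβA := mul_nonneg hβ.le hA0
  constructor
  · by_contra h
    rw [not_lt] at h
    have h1 := mul_le_mul_of_nonneg_right h hl43.le
    have h2 := mul_le_mul_of_nonneg_left
      (show 2 * Real.log 2 - Real.log 3 ≤ Real.log 3 - Real.log 2 by linarith) hρ
    linarith
  · by_contra h
    rw [not_le] at h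
    have h1 := mul_le_mul_of_nonneg_right h.le hl43.le
    have h2 := mul_le_mul_of_nonneg_left hA hβ.le
    have h3 : 0 ≤ ρ * (Real.log 3 - Real.log 2) := mul_nonneg hρ (by linarith)
    linarith

/-- **The entropy comparison** `min(H_Y, H_X) ≤ H(x, (1−x)/2, (1−x)/2)` on the whole simplex, for `k ≥ 341`
past the threshold: region RX by `certX`, else `certY` (`x ≥ 1/3`) or `certF` (`x < 1/3`). -/
theorem min_entropy_le_ref {k β σ ρ c' x : ℝ} (hk : 341 ≤ k) (hβ : 0 < β) (hσ : 0 ≤ σ) (hρ : 0 ≤ ρ)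
    (hc'0 : 0 < c') (hc'h : c' ≤ 1 / 2) (hsum : (k + 2) * β + 2 * σ + ρ = 1) (hx : x = (k + 1 + c') * β)
    (hT : c' * (3 * Real.log 2 - 1 / 2 * Real.log 3 + Real.log (k + 2)) ≤ 3 / 2 * Real.log 3 - 2 * Real.log 2) :
    min (shannon₃ (k * β + 2 * σ) (2 * β) ρ) (shannon₃ (β + ρ + σ) (k * β + β) σ) ≤
      shannon₃ x ((1 - x) / 2) ((1 - x) / 2) := by
  have hk0 : 0 ≤ k := by linarith
  have hx0 : 0 < x := by rw [hx]; positivity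
  have hxe : x = 1 - 2 * σ - ρ - (1 - c') * β := by rw [hx]; linarith
  have h1x : (1 - c') * β ≤ 1 - x := by rw [hxe]; linarith
  have h1c : 0 < (1 - c') * β := mul_pos (by linarith) hβ
  by_cases hRX : 0 ≤ β * (Real.log 3 - (1 + c') * Real.log 2) + σ * (Real.log 3 - 2 * Real.log 2) +
      ρ * (Real.log 3 - Real.log 2) + c' * β * (Real.log (1 - x) - Real.log x)
  · -- region RX: the X-certificate has non-negative slack
    have hX := certX hk0 hβ hσ hρ hc'0.le (by linarith) hsum hx
    exact (min_le_right _ _).trans (by linarith)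
  · rw [not_le] at hRX
    have hL := logCorrection_lower hk0 hβ hc'0 hc'h hx h1x
    obtain ⟨hρσ, hs⟩ := negSlack_consequences hβ hρ hc'0 hT hL hRX
    by_cases hx3 : 1 / 3 ≤ x
    · -- region RY: the Y-certificate has non-negative slack
      have hY := certY hk0 hβ hσ hρ hc'0.le (by linarith) hsum hx
      have hlog : Real.log (1 - x) ≤ Real.log (2 * x) := Real.log_le_log (by linarith) (by linarith)
      have hnn : 0 ≤ (2 * σ - (1 + c') * β) * (Real.log (2 * x) - Real.log (1 - x)) :=
        mul_nonneg (by linarith) (by linarith)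
      exact (min_le_left _ _).trans (by linarith)
    · -- far region F: `x < 1/3` forces `2β ≤ 2⁻⁹` (`k ≥ 341`), and `H_Y < log 2 ≤ H_ref`
      rw [not_le] at hx3
      have hβs : 2 * β ≤ 1 / 512 := by
        have h342 : (342 : ℝ) * β ≤ x := by
          rw [hx]; exact mul_le_mul_of_nonneg_right (by linarith) hβ.le
        linarith
      have hF := certF hk0 hβ hρ hsum hρσ.le hβs
      have hR := log_two_le_entropyRef hx0 hx3.le
      exact (min_le_left _ _).trans (by linarith)

/-- **The ceiling of the first-power class** (core form, `0 < c < c₁`): for `k ≥ max 341 ⌈exp((5/2)c/(c₁−c))⌉`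
EVERY admissible instance of `cwFullFirstPowerValue` is at least `k + 1 + c / log k`. -/
theorem firstPowerCeiling_pos {c : ℝ} (hc0 : 0 < c) (hc : c < 3 / 2 * Real.log 3 - 2 * Real.log 2) :
    ∃ k₀ : ℕ, 2 ≤ k₀ ∧ ∀ k : ℕ, k₀ ≤ k → ∀ q : ℕ, 2 ≤ q → ∀ σ ρ : ℝ, 0 ≤ σ → 0 ≤ ρ → 2 * σ + ρ < 1 →
      (k : ℝ) + 1 + c / Real.log k ≤ cwFullFirstPowerValue q k σ ρ := by
  have hl2l := Real.log_two_gt_d9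
  have hc₁ := cwFarEdgeConstant_bounds
  -- `4 log 2 − (1/2) log 3 ≤ 5/2`
  have hnum : 4 * Real.log 2 - 1 / 2 * Real.log 3 ≤ 5 / 2 := by
    have h2 := Real.log_two_lt_d9
    have h23 : Real.log 2 ≤ Real.log 3 := Real.log_le_log two_pos (by norm_num)
    linarith
  have hgap : 0 < 3 / 2 * Real.log 3 - 2 * Real.log 2 - c := by linarith
  -- the threshold `k₀ = max 341 ⌈exp B⌉`, `B = (5/2) c / (c₁ − c)`
  set B : ℝ := 5 / 2 * c / (3 / 2 * Real.log 3 - 2 * Real.log 2 - c) with hB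
  obtain ⟨k₂, hk₂⟩ : ∃ k₂ : ℕ, Real.exp B ≤ k₂ := ⟨⌈Real.exp B⌉₊, Nat.le_ceil _⟩
  refine ⟨max 341 k₂, le_trans (by norm_num) (le_max_left _ _), ?_⟩
  intro k hk q hq σ ρ hσ hρ hσρ
  have hk341 : (341 : ℕ) ≤ k := le_trans (le_max_left _ _) hk
  have hkk₂ : k₂ ≤ k := le_trans (le_max_right _ _) hk
  have hkR : (341 : ℝ) ≤ (k : ℝ) := by exact_mod_cast hk341
  have hqR : (2 : ℝ) ≤ (q : ℝ) := by exact_mod_cast hq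
  have hlogk : 0 < Real.log (k : ℝ) := Real.log_pos (by linarith)
  have hlogq : 0 < Real.log (q : ℝ) := Real.log_pos (by linarith)
  have hl2k : Real.log 2 ≤ Real.log (k : ℝ) := Real.log_le_log two_pos (by linarith)
  have hBk : 5 / 2 * c / (3 / 2 * Real.log 3 - 2 * Real.log 2 - c) ≤ Real.log (k : ℝ) := by
    have hexp : Real.exp B ≤ (k : ℝ) := le_trans hk₂ (by exact_mod_cast hkk₂)
    have h := Real.log_le_log (Real.exp_pos B) hexp
    rwa [Real.log_exp, hB] at h
  -- `c' = c / log k ∈ (0, 1/2]` and the threshold inequality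
  set c' : ℝ := c / Real.log (k : ℝ) with hc'
  have hc'0 : 0 < c' := div_pos hc0 hlogk
  have hcc : c' * Real.log (k : ℝ) = c := div_mul_cancel₀ c hlogk.ne'
  have hc'h : c' ≤ 1 / 2 := by
    rw [hc', div_le_iff₀ hlogk]; linarith [hc₁.2]
  have h52 : 5 / 2 * c' ≤ 3 / 2 * Real.log 3 - 2 * Real.log 2 - c := by
    have h1 := (div_le_iff₀ hgap).mp hBk
    rw [hc', show (5 : ℝ) / 2 * (c / Real.log (k : ℝ)) = 5 / 2 * c / Real.log (k : ℝ) by ring,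
      div_le_iff₀ hlogk]
    linarith
  have hT : c' * (3 * Real.log 2 - 1 / 2 * Real.log 3 + Real.log ((k : ℝ) + 2)) ≤
      3 / 2 * Real.log 3 - 2 * Real.log 2 := by
    have hlk2 : Real.log ((k : ℝ) + 2) ≤ Real.log 2 + Real.log (k : ℝ) := by
      rw [← Real.log_mul two_ne_zero (by positivity)]
      exact Real.log_le_log (by positivity) (by linarith)
    have a1 := mul_le_mul_of_nonneg_left hlk2 hc'0.le
    have a2 := mul_le_mul_of_nonneg_left hnum hc'0.le
    linarith
  -- `β = (1 − 2σ − ρ)/(k+2)`, `x = (k + 1 + c') β`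
  unfold cwFullFirstPowerValue
  set β : ℝ := (1 - 2 * σ - ρ) / ((k : ℝ) + 2) with hβ
  have hβ0 : 0 < β := div_pos (by linarith) (by positivity)
  have hsum : ((k : ℝ) + 2) * β + 2 * σ + ρ = 1 := by
    have hk2ne : (k : ℝ) + 2 ≠ 0 := by positivity
    rw [hβ]; field_simp; ring
  obtain ⟨x, hx⟩ : ∃ x : ℝ, x = ((k : ℝ) + 1 + c') * β := ⟨_, rfl⟩
  have hx0 : 0 < x := by rw [hx]; positivity
  have hx1 : x < 1 := by
    have hxe : x = 1 - 2 * σ - ρ - (1 - c') * β := by rw [hx]; linarith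
    have h1c : 0 < (1 - c') * β := mul_pos (by linarith) hβ0
    rw [hxe]; linarith
  -- Step (1): `q`-elimination; Steps (2)+(3): the entropy comparison
  have href := entropyRef_le_log hx0 hx1 (by linarith : (0 : ℝ) < (q : ℝ))
  have key := min_entropy_le_ref hkR hβ0 hσ hρ hc'0 hc'h hsum hx hT
  rw [le_div_iff₀ (mul_pos hβ0 hlogq)]
  have ex : ((k : ℝ) + 1 + c') * (β * Real.log (q : ℝ)) = x * Real.log (q : ℝ) := by rw [hx]; ring
  rw [ex]
  linarith

/-- **The ceiling of the full first-power `CW_q` certificate family at the far edge.**  For every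
`c < c₁ = (3/2) log 3 − 2 log 2` there is `k₀ ≥ 2` such that for all `k ≥ k₀` and ALL admissible parameters
(`q ≥ 2`; symmetric joint types `(m, m, k·m; s, s, r)`, i.e. `σ, ρ ≥ 0`, `2σ + ρ < 1`) the certificate value is at
least `k + 1 + c / log k`: no instance of the landed class proves a far-edge rung `ω(1,k,1) − (k+1) ≤ c / log k`
with `c < c₁` at any large `k`. -/
theorem firstPowerCeiling (c : ℝ) (hc : c < 3 / 2 * Real.log 3 - 2 * Real.log 2) :
    ∃ k₀ : ℕ, 2 ≤ k₀ ∧ ∀ k : ℕ, k₀ ≤ k → ∀ q : ℕ, 2 ≤ q → ∀ σ ρ : ℝ, 0 ≤ σ → 0 ≤ ρ → 2 * σ + ρ < 1 →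
      (k : ℝ) + 1 + c / Real.log k ≤ cwFullFirstPowerValue q k σ ρ := by
  have hc₁ := cwFarEdgeConstant_pos
  have hp0 : 0 < max c ((3 / 2 * Real.log 3 - 2 * Real.log 2) / 2) :=
    lt_of_lt_of_le (by linarith) (le_max_right _ _)
  have hp1 : max c ((3 / 2 * Real.log 3 - 2 * Real.log 2) / 2) < 3 / 2 * Real.log 3 - 2 * Real.log 2 :=
    max_lt hc (by linarith)
  obtain ⟨k₀, hk₀, H⟩ := firstPowerCeiling_pos hp0 hp1
  refine ⟨k₀, hk₀, fun k hk q hq σ ρ hσ hρ hσρ => le_trans ?_ (H k hk q hq σ ρ hσ hρ hσρ)⟩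
  have hk2 : (2 : ℝ) ≤ (k : ℝ) := by exact_mod_cast hk₀.trans hk
  have hmono : c / Real.log (k : ℝ) ≤ max c ((3 / 2 * Real.log 3 - 2 * Real.log 2) / 2) / Real.log (k : ℝ) :=
    div_le_div_of_nonneg_right (le_max_left _ _) (Real.log_nonneg (by linarith))
  linarith

/-- The same ceiling for the INTEGER certificate `CwFirstPowerIntegerCertificate` (parameters `q, m ≥ 1, s, r`
with `σ = s/N₀`, `ρ = r/N₀`, `N₀ = (k+2)m + 2s + r`), i.e. for exactly the instances the landed theorem
`cwFirstPowerIntegerCertificate_holds` feeds into `ω(1,k,1)`. -/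
theorem firstPowerCeiling_integer (c : ℝ) (hc : c < 3 / 2 * Real.log 3 - 2 * Real.log 2) :
    ∃ k₀ : ℕ, 2 ≤ k₀ ∧ ∀ k : ℕ, k₀ ≤ k → ∀ q m s r : ℕ, 2 ≤ q → 1 ≤ m →
      (k : ℝ) + 1 + c / Real.log k ≤
        cwFullFirstPowerValue q k ((s : ℝ) / (((k : ℝ) + 2) * m + 2 * s + r))
          ((r : ℝ) / (((k : ℝ) + 2) * m + 2 * s + r)) := by
  obtain ⟨k₀, hk₀, H⟩ := firstPowerCeiling c hc
  refine ⟨k₀, hk₀, fun k hk q m s r hq hm => H k hk q hq _ _ (by positivity) (by positivity) ?_⟩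
  have hmR : (1 : ℝ) ≤ (m : ℝ) := by exact_mod_cast hm
  have hN : (0 : ℝ) < ((k : ℝ) + 2) * m + 2 * s + r := by positivity
  have e : 2 * ((s : ℝ) / (((k : ℝ) + 2) * m + 2 * s + r)) + (r : ℝ) / (((k : ℝ) + 2) * m + 2 * s + r) =
      (2 * (s : ℝ) + r) / (((k : ℝ) + 2) * m + 2 * s + r) := by ring
  have hkm : (0 : ℝ) < ((k : ℝ) + 2) * m := by positivity
  rw [e, div_lt_one hN]
  linarith

/-! ## Reading for the open aside `SubLogRate` (stmt-MatrixMultiplication-25371) -/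

/-- **`SubLogRate` lies beyond the first-power class, by theorem.**  If the aside holds then, eventually in `k`,
`ω(1,k,1)` is STRICTLY below every value of the full first-power certificate family — uniformly in all
admissible parameters: the aside cannot be certified by any parameter choice in the class (it needs a new
ingredient), while every constant `c > c₁` IS certified (`logRateSharp_explicit`). -/
theorem omegaRect_lt_firstPower_of_subLogRate (h : SubLogRate) :
    ∃ k₀ : ℕ, 2 ≤ k₀ ∧ ∀ k : ℕ, k₀ ≤ k → ∀ q : ℕ, 2 ≤ q → ∀ σ ρ : ℝ, 0 ≤ σ → 0 ≤ ρ → 2 * σ + ρ < 1 →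
      omegaRect ℂ 1 k 1 < cwFullFirstPowerValue q k σ ρ := by
  have hc₁ := cwFarEdgeConstant_pos
  obtain ⟨k₁, hk₁, H₁⟩ := h ((3 / 2 * Real.log 3 - 2 * Real.log 2) / 4) (by linarith)
  obtain ⟨k₂, hk₂, H₂⟩ := firstPowerCeiling ((3 / 2 * Real.log 3 - 2 * Real.log 2) / 2) (by linarith)
  refine ⟨max k₁ k₂, le_trans hk₁ (le_max_left _ _), fun k hk q hq σ ρ hσ hρ hσρ => ?_⟩
  have h1 := H₁ k (le_trans (le_max_left _ _) hk)
  have h2 := H₂ k (le_trans (le_max_right _ _) hk) q hq σ ρ hσ hρ hσρ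
  have hk2 : (2 : ℝ) ≤ (k : ℝ) := by exact_mod_cast hk₁.trans (le_trans (le_max_left _ _) hk)
  have hlogk : 0 < Real.log (k : ℝ) := Real.log_pos (by linarith)
  have hlt : (3 / 2 * Real.log 3 - 2 * Real.log 2) / 4 / Real.log (k : ℝ) <
      (3 / 2 * Real.log 3 - 2 * Real.log 2) / 2 / Real.log (k : ℝ) :=
    (div_lt_div_iff_of_pos_right hlogk).mpr (by linarith)
  have h1' : omegaRect ℂ 1 (k : ℝ) 1 - ((k : ℝ) + 1) ≤ (3 / 2 * Real.log 3 - 2 * Real.log 2) / 4 / Real.log (k : ℝ) := by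
    exact_mod_cast h1
  linarith

/-- Contrapositive packaging: the route's rate ladder on the special side is now closed from BOTH sides at the
constant — `(c₁, ∞)` is realised by the class (`logRateSharp_explicit`), `(−∞, c₁)` is refused by the class
(`firstPowerCeiling`); the aside `SubLogRate` (= the rungs `c ∈ (0, c₁]`, `subLogRate_iff_below_constant`) is
therefore decided by NO instance of the first-power Coppersmith–Winograd method. -/
theorem firstPower_rate_dichotomy (c : ℝ) (hc : c ≠ 3 / 2 * Real.log 3 - 2 * Real.log 2) :
    (3 / 2 * Real.log 3 - 2 * Real.log 2 < c ∧
        ∃ k₀ : ℕ, 2 ≤ k₀ ∧ ∀ k : ℕ, k₀ ≤ k → omegaRect ℂ 1 k 1 - (k + 1) ≤ c / Real.log k) ∨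
      (c < 3 / 2 * Real.log 3 - 2 * Real.log 2 ∧
        ∃ k₀ : ℕ, 2 ≤ k₀ ∧ ∀ k : ℕ, k₀ ≤ k → ∀ q : ℕ, 2 ≤ q → ∀ σ ρ : ℝ, 0 ≤ σ → 0 ≤ ρ → 2 * σ + ρ < 1 →
          (k : ℝ) + 1 + c / Real.log k ≤ cwFullFirstPowerValue q k σ ρ) := by
  rcases lt_or_gt_of_ne hc with hlt | hgt
  · exact Or.inr ⟨hlt, firstPowerCeiling c hlt⟩
  · exact Or.inl ⟨hgt, logRateSharp_explicit c hgt⟩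

end Summit.MatrixMultiplication.MatrixMultiplication.Theorems.FarEdgeDescentFirstPowerCeiling

end
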